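import Mathlib.Analysis.InnerProductSpace.PiL2
import Mathlib.MeasureTheory.Measure.Haar.InnerProductSpace
import Mathlib.Topology.UniformSpace.LocallyUniformConvergence
import Mathlib.MeasureTheory.Constructions.BorelSpace.Basic
import HarnessLib

/-!
# Route `ExtremiserTransience`, LINE g5-α repair (seat ns-idea-5 g5): PLATEAU PERSISTENCE under locally uniform convergence

`--supports stmt-NavierStokesRegularity-27822` (`PlateauSliceTransfer`).  This is stub S3 `stub_plateauPersistence` of the skeleton
«moving-centre zoom» for 27822 (evidence file `PlateauSliceTransfer_skeleton.lean`, composition `PlateauSliceTransfer_of : S1 → S2 → S3 → PlateauSliceTransfer`),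
proved outright.  It is route-independent pure measure theory:

> if `(s, y) ↦ V_k s y` converges locally uniformly on `(−∞,0) × ℝ³` to a continuous `W`, the times `s_k < 0` tend to `t₀ < 0`, the levels `m_k → m₀ > 0`,
> `δ_k → 0`, every slice `V_k(s_k, ·)` is continuous and bounded by `m_k`, and its near-plateau set `{y ∈ B(0,R) : ‖V_k(s_k,y)‖ ≥ (1−δ_k) m_k}` has
> volume `≥ η > 0` for every `k`, then `‖W(t₀, ·)‖ ≤ m₀` everywhere and the EXACT plateau `{‖W(t₀,·)‖ = m₀}` has positive volume

(it contains `limsup_k` of the near-plateau sets, whose volume is `≥ η` by continuity of the measure from above inside the ball).  This is the step of the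
transfer where the moving-centre zoom of a near-extremal Type-I flow turns LNPS's near-plateaus into an exact positive-volume plateau of ONE slice of the
blow-up limit (the object 27823 `PlateauSliceRigidity` forbids).  HONEST FRAMING: an elementary lemma; nothing about Navier–Stokes is proved here and no
summit is proved by a line. [folklore]
-/

open scoped Topology
open Filter Set MeasureTheory

namespace Summit.NavierStokesRegularity.NavierStokesRegularity.Theorems.ExtremiserTransience
set_option linter.dupNamespace false

/-- **Plateau persistence** (stub S3 of the 27822 skeleton, verbatim statement). [folklore] -/
theorem plateauPersistence : ∀ (V : ℕ → ℝ → EuclideanSpace ℝ (Fin 3) → EuclideanSpace ℝ (Fin 3)) (W : ℝ → EuclideanSpace ℝ (Fin 3) → EuclideanSpace ℝ (Fin 3)) (s m δ : ℕ → ℝ) (η R t₀ m₀ : ℝ), TendstoLocallyUniformlyOn (fun k => Function.uncurry (V k)) (Function.uncurry W) Filter.atTop (Set.Iio (0 : ℝ) ×ˢ Set.univ) → ContinuousOn (Function.uncurry W) (Set.Iio (0 : ℝ) ×ˢ Set.univ) → 0 < η → t₀ < 0 → 0 < m₀ → (∀ k, s k < 0 ∧ Continuous (fun y => V k (s k) y)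 ∧ (∀ y, ‖V k (s k) y‖ ≤ m k) ∧ ENNReal.ofReal η ≤ MeasureTheory.volume {y : EuclideanSpace ℝ (Fin 3) | y ∈ Metric.ball 0 R ∧ (1 - δ k) * m k ≤ ‖V k (s k) y‖}) → Filter.Tendsto s Filter.atTop (nhds t₀) → Filter.Tendsto m Filter.atTop (nhds m₀) → Filter.Tendsto δ Filter.atTop (nhds 0) → (∀ y, ‖W t₀ y‖ ≤ m₀) ∧ 0 < MeasureTheory.volume {y : EuclideanSpace ℝ (Fin 3) | ‖W t₀ y‖ = m₀} := by
  intro V W s m δ η R t₀ m₀ hconv hWc hη ht₀ hm₀ hk hs hm hδ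
  -- pointwise convergence of the slices at the moving times
  have hpt : ∀ y, Tendsto (fun k => V k (s k) y) atTop (𝓝 (W t₀ y)) := by
    intro y
    have hx : (t₀, y) ∈ Iio (0 : ℝ) ×ˢ (univ : Set (EuclideanSpace ℝ (Fin 3))) := ⟨ht₀, mem_univ _⟩
    have hg : Tendsto (fun k => (s k, y)) atTop (𝓝[Iio (0 : ℝ) ×ˢ univ] (t₀, y)) := by
      refine tendsto_nhdsWithin_iff.2 ⟨?_, Eventually.of_forall fun k => ⟨(hk k).1, mem_univ _⟩⟩
      exact hs.prodMk_nhds tendsto_const_nhds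
    have h := hconv.tendsto_comp (hWc.continuousWithinAt hx) hx hg
    simpa [Function.uncurry] using h
  -- (1) the slice sup bound passes to the limit
  have h1 : ∀ y, ‖W t₀ y‖ ≤ m₀ := fun y =>
    le_of_tendsto_of_tendsto (hpt y).norm hm (Eventually.of_forall fun k => (hk k).2.2.1 y)
  refine ⟨h1, ?_⟩
  -- (2) the near-plateau sets and their limsup
  set P : ℕ → Set (EuclideanSpace ℝ (Fin 3)) :=
    fun k => {y | y ∈ Metric.ball (0 : EuclideanSpace ℝ (Fin 3)) R ∧ (1 - δ k) * m k ≤ ‖V k (s k) y‖} with hP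
  have hPmeas : ∀ k, MeasurableSet (P k) := by
    intro k
    have hc : Continuous fun y => ‖V k (s k) y‖ := (hk k).2.1.norm
    have : P k = Metric.ball 0 R ∩ {y | (1 - δ k) * m k ≤ ‖V k (s k) y‖} := by
      ext y; simp [hP]
    rw [this]
    exact Metric.isOpen_ball.measurableSet.inter (measurableSet_le measurable_const hc.measurable)
  set B : ℕ → Set (EuclideanSpace ℝ (Fin 3)) := fun n => ⋃ k, ⋃ (_ : n ≤ k), P k with hB
  have hBmeas : ∀ n, MeasurableSet (B n) := fun n =>
    MeasurableSet.iUnion fun k => MeasurableSet.iUnion fun _ => hPmeas k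
  have hBanti : Antitone B := by
    intro n n' hnn' y hy
    simp only [hB, mem_iUnion] at hy ⊢
    obtain ⟨k, hk', hyk⟩ := hy
    exact ⟨k, hnn'.trans hk', hyk⟩
  have hBsub : ∀ n, B n ⊆ Metric.ball 0 R := by
    intro n y hy
    simp only [hB, mem_iUnion] at hy
    obtain ⟨k, -, hyk⟩ := hy
    exact hyk.1
  have hBfin : volume (B 0) ≠ ⊤ :=
    (lt_of_le_of_lt (measure_mono (hBsub 0)) Metric.isBounded_ball.measure_lt_top).ne
  have hlim : Tendsto (fun n => volume (B n)) atTop (𝓝 (volume (⋂ n, B n))) :=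
    tendsto_measure_iInter_atTop (fun n => (hBmeas n).nullMeasurableSet) hBanti ⟨0, hBfin⟩
  have hge : ∀ n, ENNReal.ofReal η ≤ volume (B n) := by
    intro n
    refine ((hk n).2.2.2).trans (measure_mono ?_)
    intro y hy
    simp only [hB, mem_iUnion]
    exact ⟨n, le_rfl, hy⟩
  have hcap : ENNReal.ofReal η ≤ volume (⋂ n, B n) := ge_of_tendsto hlim (Eventually.of_forall hge)
  -- (3) limsup of the near-plateau sets lies in the exact plateau
  have hincl : (⋂ n, B n) ⊆ {y | ‖W t₀ y‖ = m₀} := by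
    intro y hy
    simp only [mem_iInter, hB, mem_iUnion] at hy
    refine le_antisymm (h1 y) ?_
    by_contra hlt
    push Not at hlt
    set ε : ℝ := (m₀ - ‖W t₀ y‖) / 2 with hε
    have hεpos : 0 < ε := by rw [hε]; linarith
    have hevV : ∀ᶠ k in atTop, ‖V k (s k) y‖ < ‖W t₀ y‖ + ε :=
      (hpt y).norm.eventually (Iio_mem_nhds (by linarith))
    have hprod : Tendsto (fun k => (1 - δ k) * m k) atTop (𝓝 m₀) := by
      have := (tendsto_const_nhds (x := (1 : ℝ)).sub hδ).mul hm
      simpa using this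
    have hevL : ∀ᶠ k in atTop, m₀ - ε < (1 - δ k) * m k := hprod.eventually (Ioi_mem_nhds (by linarith))
    obtain ⟨N, hN⟩ := (hevV.and hevL).exists_forall_of_atTop
    obtain ⟨k, hNk, hyk⟩ := hy N
    have hk1 := (hN k hNk).1
    have hk2 := (hN k hNk).2
    have hyk2 : (1 - δ k) * m k ≤ ‖V k (s k) y‖ := hyk.2
    rw [hε] at hk1 hk2
    linarith
  have hpos : 0 < ENNReal.ofReal η := ENNReal.ofReal_pos.2 hη
  exact lt_of_lt_of_le (lt_of_lt_of_le hpos hcap) (measure_mono hincl)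

end Summit.NavierStokesRegularity.NavierStokesRegularity.Theorems.ExtremiserTransience
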